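import Mathlib
import Literature.FieldTheory.AlgClosed.AutomorphismExtension
import HarnessLib

/-!
# (S3): one automorphism of `ℂ` moving all transcendental entries of a countable family
# off a countable subfield

For a countable subfield `M ⊆ ℂ` and a countable family `a : ι → ℂ` there is `σ ∈ Aut(ℂ/ℚ)` with
`σ (a v) ∉ M` for every `v` such that `a v` is transcendental over `ℚ`.

Proof.  Let `K = ℚ(M ∪ range a)` (countable), `B` a transcendence basis of `K / ℚ`, and `T` a
transcendence basis of `ℂ / K`; since `#T = #ℂ > ℵ₀ ≥ #B` there is an injection `f : B ↪ T`, and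
`y = f(B)` is algebraically independent over `K`.  The isomorphism `ℚ[B] ≅ ℚ[y]` extends
(`IsAlgClosed.lift`, `K` being algebraic over `ℚ[B]`) to an embedding `ψ : K → ℂ` whose image is
algebraic over `ℚ[y]`.  On the other hand an element of `K` transcendental over `ℚ` stays
transcendental over `ℚ[y]` (`y` is algebraically independent over `K`), so `ψ` maps the
transcendental elements of `K` outside `K ⊇ M`.  Finally `ψ` is the restriction of an automorphism
of `ℂ` (`Literature.FieldTheory.AlgClosed.exists_ringEquiv_apply_eq`).
-/

noncomputable section

open Cardinal

set_option linter.dupNamespace false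

namespace Summit.Langlands.Langlands.Theorems.HeckeEigenvalueField.Baire

/-- If `y` is a family of complex numbers algebraically independent over a subfield `L ⊆ ℂ`, then
every element of `L` transcendental over `ℚ` is transcendental over `ℚ[y]`. [folklore] -/
theorem transcendental_adjoin_of_algebraicIndependent (L : IntermediateField ℚ ℂ) {κ : Type}
    {y : κ → ℂ} (hy : AlgebraicIndependent L y) {w : ℂ} (hwL : w ∈ L)
    (hw : Transcendental ℚ w) :
    Transcendental (Algebra.adjoin ℚ (Set.range y)) w := by
  have hw' : Transcendental ℚ (⟨w, hwL⟩ : L) := fun h => hw h.algebraMap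
  have h1 : AlgebraicIndependent ℚ (fun _ : Unit => (⟨w, hwL⟩ : L)) :=
    algebraicIndependent_unique_type_iff.mpr hw'
  have h2 := h1.sumElim_comp hy
  have h3 : AlgebraicIndependent ℚ (fun o : Option κ => o.elim w y) := by
    have h4 := h2.comp (fun o : Option κ => o.elim (Sum.inr ()) Sum.inl) (by
      intro o₁ o₂ h
      cases o₁ <;> cases o₂ <;> simp_all)
    convert h4 using 1
    ext (_ | _) <;> rfl
  exact (AlgebraicIndependent.option_iff.mp h3).2

/-- If `x` is a transcendence basis of a field `K` over `ℚ` and `y` is a family of complex numbers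
algebraically independent over `ℚ` indexed by the same type, then there is an embedding
`ψ : K →+* ℂ` whose image is algebraic over `ℚ[y]` (extend `ℚ[x] ≅ ℚ[y]` to `K`, which is
algebraic over `ℚ[x]`). [folklore] -/
theorem exists_ringHom_isAlgebraic_adjoin {K : Type} [Field K] [Algebra ℚ K] {κ : Type}
    {x : κ → K} (hx : IsTranscendenceBasis ℚ x) {y : κ → ℂ} (hy : AlgebraicIndependent ℚ y) :
    ∃ ψ : K →+* ℂ, ∀ z : K, IsAlgebraic (Algebra.adjoin ℚ (Set.range y)) (ψ z) := by
  let θ : Algebra.adjoin ℚ (Set.range x) ≃ₐ[ℚ] Algebra.adjoin ℚ (Set.range y) :=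
    hx.1.aevalEquiv.symm.trans hy.aevalEquiv
  letI : Algebra (Algebra.adjoin ℚ (Set.range x)) ℂ :=
    ((algebraMap (Algebra.adjoin ℚ (Set.range y)) ℂ).comp
      (θ : Algebra.adjoin ℚ (Set.range x) →+* Algebra.adjoin ℚ (Set.range y))).toAlgebra
  haveI : Module.IsTorsionFree (Algebra.adjoin ℚ (Set.range x)) ℂ :=
    Module.isTorsionFree_iff_algebraMap_injective.mpr
      (Subtype.val_injective.comp θ.injective)
  haveI : Algebra.IsAlgebraic (Algebra.adjoin ℚ (Set.range x)) K := hx.isAlgebraic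
  let ψ : K →ₐ[Algebra.adjoin ℚ (Set.range x)] ℂ := IsAlgClosed.lift
  refine ⟨ψ.toRingHom, fun z => ?_⟩
  have hz : IsAlgebraic (Algebra.adjoin ℚ (Set.range x)) z := Algebra.IsAlgebraic.isAlgebraic z
  refine hz.ringHom_of_comp_eq
    (θ : Algebra.adjoin ℚ (Set.range x) →+* Algebra.adjoin ℚ (Set.range y)) ψ.toRingHom
    θ.injective ?_
  ext r
  exact (ψ.commutes r).symm

/-- **(S3).** For a countable subfield `M ⊆ ℂ` and a countable family `a`, one automorphism of `ℂ` moves every transcendental `a v`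
outside `M`. [folklore] -/
theorem stub_S3 : ∀ (M : Subfield ℂ), Cardinal.mk M ≤ Cardinal.aleph0 →
    ∀ (ι : Type) [Countable ι] (a : ι → ℂ),
      ∃ σ : ℂ ≃ₐ[ℚ] ℂ, ∀ v, Transcendental ℚ (a v) → σ (a v) ∉ M := by
  intro M hM ι _ a
  -- the countable subfield `K = ℚ(M ∪ range a)`
  have hSc : ((M : Set ℂ) ∪ Set.range a).Countable :=
    ((Cardinal.le_aleph0_iff_set_countable (s := (M : Set ℂ))).mp hM).union
      (Set.countable_range a)
  obtain ⟨K, hMK, haK, hK⟩ : ∃ K : IntermediateField ℚ ℂ,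
      (∀ c ∈ M, c ∈ K) ∧ (∀ v, a v ∈ K) ∧ #K ≤ ℵ₀ := by
    refine ⟨IntermediateField.adjoin ℚ ((M : Set ℂ) ∪ Set.range a),
      fun c hc => IntermediateField.subset_adjoin ℚ _ (Or.inl hc),
      fun v => IntermediateField.subset_adjoin ℚ _ (Or.inr ⟨v, rfl⟩), ?_⟩
    refine (IntermediateField.cardinalMk_adjoin_le ℚ _).trans ?_
    rw [sup_le_iff, sup_le_iff]
    exact ⟨⟨Cardinal.mk_le_aleph0, Cardinal.le_aleph0_iff_set_countable.mpr hSc⟩, le_rfl⟩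
  have hC : ℵ₀ < #ℂ := by
    rw [Cardinal.mk_complex]
    exact Cardinal.aleph0_lt_continuum
  -- transcendence bases of `K / ℚ` and of `ℂ / K`, and an injection between them
  obtain ⟨B, hB⟩ := exists_isTranscendenceBasis ℚ K
  obtain ⟨T, hT⟩ := exists_isTranscendenceBasis K ℂ
  have hcT : #ℂ = #T :=
    IsAlgClosed.cardinal_eq_cardinal_transcendence_basis_of_aleph0_lt' _ hT hK hC
  have hBT : #B ≤ #T := by
    rw [← hcT]
    exact ((Cardinal.mk_set_le B).trans hK).trans hC.le
  obtain ⟨f⟩ := (Cardinal.le_def _ _).mp hBT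
  -- the family `y = f(B)`, algebraically independent over `K` (and over `ℚ`)
  have hyK : AlgebraicIndependent K (fun b : B => ((f b : T) : ℂ)) := hT.1.comp f f.injective
  have hyℚ : AlgebraicIndependent ℚ (fun b : B => ((f b : T) : ℂ)) :=
    hyK.restrictScalars (algebraMap ℚ K).injective
  -- the embedding `ψ : K → ℂ` with image algebraic over `ℚ[y]`, and its extension to `ℂ`
  obtain ⟨ψ, hψ⟩ := exists_ringHom_isAlgebraic_adjoin hB hyℚ
  obtain ⟨σ₀, hσ₀⟩ :=
    Literature.FieldTheory.AlgClosed.exists_ringEquiv_apply_eq hC hK (algebraMap K ℂ) ψ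
  refine ⟨AlgEquiv.ofRingEquiv (f := σ₀) fun q => ?_, fun v hv hvM => ?_⟩
  · rw [Algebra.algebraMap_eq_smul_one, map_rat_smul, map_one]
  · have h1 : σ₀ (a v) = ψ ⟨a v, haK v⟩ := hσ₀ ⟨a v, haK v⟩
    have h2 : ψ ⟨a v, haK v⟩ ∈ K := by
      refine hMK _ ?_
      rw [← h1]
      exact hvM
    refine transcendental_adjoin_of_algebraicIndependent K hyK h2 ?_ (hψ _)
    -- `ψ (a v)` is transcendental over `ℚ`
    have hz : Transcendental ℚ (⟨a v, haK v⟩ : K) := fun h => hv h.algebraMap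
    exact hz.ringHom_of_comp_eq (RingHom.id ℚ) ψ Function.surjective_id ψ.injective
      (Subsingleton.elim _ _)

end Summit.Langlands.Langlands.Theorems.HeckeEigenvalueField.Baire

end
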